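import Summits.PneNP.PneNP.Theses.SzkEntropy
import Literature.Computability.Complexity.PolynomialEntropyApproximation
import Literature.Computability.Complexity.PromiseCookReductionsProofs
import HarnessLib.Audit

/-!
# Line `polarize-to-one-bit-leakage` — skeleton for crux `SzkEntropy.PeaTwoMemBPP`
(item stmt-PneNP-10778, route route-PneNP-SzkEntropy; crux idea card
`Cruxes/PeaTwoMemBPP/Ideas/polarize-to-one-bit-leakage.md`, ideator cruxidea-stmt-PneNP-10778-1;
triage r1: pass ×3 — TRIAGE-r1-1 "honest NORMAL FORM (extreme gap, one bit), not a costume",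
TRIAGE-r1-2 "the line IS MAPDEC_extreme", TRIAGE-r1-3 doubt (i) "hidden side only `1 − t^{-Ω(1)}`
unless high-entropy fine polarization [KoradaUrbanke2010] is added").

Crux (by name): `Summit.PneNP.PneNP.Theses.SzkEntropy.PeaTwoMemBPP`, `Iff.rfl`-equal to
`PEA 2 ∈ PromiseBPP'` (entropy approximation with additive gap 1 for QUADRATIC maps over `F₂` is in
textbook promise-BPP).

## The line in one paragraph

Write the precision the crux asks for as a posterior entropy, `n − H(q(U_n)) = H(X | q(X)) =
Σ_ℓ H(X_ℓ | X_{<ℓ}, q(X))`, take `t = 2^s` independent copies and apply ARIKAN'S SOURCE POLARIZATION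
to the `t` copies of each input bit `X_ℓ` with side information `(X_{<ℓ}, q(X))`: with
`U_ℓ = (X_ℓ^{(1)},…,X_ℓ^{(t)})·F^{⊗s}` (a parity circuit — LINEAR in the inputs) the conservation law
`Σ_j H(U_{ℓ,j} | U_{ℓ,<j}, side^t) = t·H(X_ℓ | X_{<ℓ}, q(X))` holds (`stub_chainRule`) and all but a
`t^{-Ω(1)}` fraction of the `t` summands lie within `t^{-Ω(1)}` (rough: `stub_polarizeRough`
[Arikan2010; GuruswamiXia2015; GuruswamiVelingker2015]) — indeed within `2^{-t^{1/4}}` (fine, BOTH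
ends: `stub_polarizeFine` [ArikanTelatar2009; KoradaUrbanke2010 Thm 16; MondelliHassaniUrbanke2016])
— of `0` or `1`.  Each summand is the conditional entropy of ONE LINEAR BIT `u = U_{ℓ,j}` of a uniform
`W ∈ F₂^{nt}` given a QUADRATIC map `Φ = (U_{ℓ,<j}, X_{<ℓ}^t, q^{×t})` of `W` (degree is preserved
because the polar transform acts linearly on the input side — the point of the card: the
Sahai–Vadhan XOR amplifier would raise the degree to 3).  So COUNTING the indices an oracle declares
"hidden" recovers `H(q(U_n))` to `±1/4`, whatever the oracle answers on the few unpolarized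
(off-promise) indices: `PEA₂` COOK-REDUCES (Goldreich 2006, Def. 3; tree `PromiseProblem.CookReducible`)
to the constant-gap one-bit problem `GapQL` — given `(u, Φ)`, `u` affine, `Φ` quadratic, decide
`H(u|Φ) ≥ 2/3` (hidden) vs `≤ 1/3` (determined) — (`stub_transfer`), and one more round of one-bit
polarization self-improves the gap: `GapQL` Cook-reduces to the EXTREME-gap version `GapQLx`
(`H(u|Φ) ≥ 1 − δ(N)` vs `≤ δ(N)`, `δ(N) = 2^{-(2^{⌊log₂N⌋/8}+1)} ≈ 2^{-N^{1/8}}`) (`stub_boost`, the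
degree-2 substitute for Sahai–Vadhan polarization).  The tree's PROVED closure of `PromiseBPP'` under
Cook reductions (`PromiseProblem.mem_PromiseBPP'_of_cookReducible_holds`, Goldreich's remark after
Def. 3) then reduces the crux to the card's `C⁺`: `GapQLx ∈ PromiseBPP'` (`stub_gapQLx`, the OPEN
CORE = "MAPDEC at extreme gap" on its coding sub-family).  Conversely `crux ⇒ GapQLx ∈ PromiseBPP'`
trivially (two `PEA₂` evaluations to `±1/8` by direct products), so `C⁺` is EQUIVALENT to the crux —
a normal form, not a weakening; what it buys is stated under `stub_gapQLx`.

## Shape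

`PeaTwoMemBPP_of : Registered.stub_chainRule → … → Registered.stub_gapQLx → PeaTwoMemBPP` concludes
the crux BY NAME (no hypotheses besides the six registered stubs; the `Registered.stub_*` abbrevs key
the stub STATEMENTS by the stub names so that `#h21_check_skeleton` admits them, device of
`Cruxes/WindowBarrier/Lines/entropy-support-dichotomy.lean`); its proof is two applications of the
tree theorem `mem_PromiseBPP'_of_cookReducible_holds` and the `Iff.rfl` identification with `PEA 2`.
`sorry` occurs only inside the six `stub_*`.  Wiring check at the end:
`example : PeaTwoMemBPP := PeaTwoMemBPP_of stub_chainRule … stub_gapQLx`.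
All stub statements are over Mathlib + `Literature.InformationTheory.Entropy.mapEntropy` +
`Literature.Computability.Complexity.{PolyMapF2, PEA, PromiseProblem.CookReducible, PromiseBPP'}` and
the transparent vocabulary of this file (`polarBit`, `leak`, `condEnt`, `qleak`, `GapQL`, `GapQLx`).

## Stubs (6): sizes and roles

* `stub_chainRule` (M) — conservation law of polarization, pure `mapEntropy` algebra (telescoping +
  `t`-fold product rule + bijectivity of `F^{⊗s}`).
* `stub_polarizeRough` (L/XL to formalise; KNOWN) — two-sided rough polarization with polynomially
  small unpolarized fraction, uniformly over all binary sources with functional side information.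
* `stub_polarizeFine` (XL to formalise; KNOWN modulo assembling printed pieces, see its docstring) —
  the same with thresholds `2^{-2^{⌊s/4⌋}}` at BOTH ends (triage doubt (i) isolated here).
* `stub_transfer` (L) — `ChainRule → PolarizeRough → (PEA 2).CookReducible GapQL` (multilevel
  polarize-and-count; an `OracleAlg` with poly-time step function).
* `stub_boost` (L) — `ChainRule → PolarizeFine → GapQL.CookReducible GapQLx` (one-bit
  polarize-and-count: degree-preserving gap amplification).
* `stub_gapQLx` (XL, OPEN CORE, hardest) — `GapQLx ∈ PromiseBPP'`.
Fallback built in: if only the rough/one-sided-fine polarization were available, `stub_chainRule`,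
`stub_polarizeRough`, `stub_transfer` still give `crux ⟸ GapQL ∈ PromiseBPP'` (constant gap), and the
lead re-points the core (`GapQL` instead of `GapQLx`) by a reshape of this file.

## Disproof used (`Cruxes/PeaTwoMemBPP/Disproof.lean`, cdisprove cycle 1 v3, 2026-08-15)

§3: the crux has NO hypothesis to drop — no `_false_without_<H>` theorem exists or can exist short of
`P ≠ NP` (`not_peaTwoMemBPP_imp_peaThreeNotInP`, `not_peaTwoMemBPP_closes`: a disproof of the crux
proves thesis X and, with `PeaMemPH`, the summit); nothing to honour stub-wise.  Landed Negative lemmas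
(`Theorems/PeaTwoMemBPP/Negative/`): `CensusDoesNotDetermineEntropy` + `CensusMultiplicative` (§4: no
function of the Dickson/Arf bias census of the pencil approximates `H` to any additive constant) and
`RenyiAndSignedDegreeReduction` (§5: Rényi-type statistics cannot reach additive gap 1; §6 signed
degree reduction) — NO stub here reads a census or a Rényi quantity: ranks/biases never enter the
skeleton (they may enter a PROOF of `stub_gapQLx` only as exact per-instance certificates, cf. the
card's mechanism (2)–(3)), and the reductions use Shannon conditional entropies only, through the
EXACT conservation law `stub_chainRule` (so the §8 warning "an estimator additive under products must
be exact" is met: the count is not a product-additive estimator, its error is controlled per index by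
polarization).  `ledger negatives --problem PneNP`: 5 refuted items, none on entropy of polynomial
maps (Disproof §7); no stub restates one.  (The Negative modules are not imported: nothing in them is
used, and `NotPeaTwoMemBPPImpliesTarget` imports the living Disproof chain's route snapshot.)
-/

noncomputable section

open Finset
open _root_.Computability
open Literature.InformationTheory.Entropy
open Literature.Computability.Complexity

namespace Summit.PneNP.PneNP.Cruxes.PeaTwoMemBPP.PolarizeToOneBitLeakage

set_option linter.dupNamespace false

/-! ## Vocabulary I — the polar transform and the abstract leakage profile

An ABSTRACT BINARY SOURCE WITH FUNCTIONAL SIDE INFORMATION is a map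
`g : ZMod 2 → (Fin m → ZMod 2) → β`: the pair `(B, W')` is uniform on `F₂ × F₂^m`, the source bit is
`B` and the side information is `Y = g B W'`.  (Every level `ℓ` of the transfer is of this form with
`B = X_ℓ`, `W' = X_{≠ℓ}`, `g = (X_{<ℓ}, q(X))`; the boost with `B = u(W)` after a linear change of
variables, `g = Φ`.)  `t = 2^s` independent copies live on `Cfg s m = Fin (2^s) → F₂ × F₂^m`. -/

/-- Row `j` of the polar transform `u = b · F^{⊗s}` over `F₂`, `F = !![1,0;1,1]`, in closed form:
`u_j = Σ_{i : bits(j) ⊆ bits(i)} b_i` (`(F^{⊗s})_{ij} = [j AND i = j]`; e.g. `s = 1`: `u₀ = b₀ + b₁`,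
`u₁ = b₁`).  Natural index order: `b·F^{⊗s} = (b·B_N)·G_N` with `G_N = B_N F^{⊗s}` Arıkan's transform
and `B_N` the bit-reversal permutation of the COPIES, so the successive conditional-entropy profile of
`(u_j)_j` in natural order is Arıkan's profile for the copy-permuted (again i.i.d.) source.
[Arikan2009, §VII (`G_N = B_N F^{⊗n}`); Arikan2010, §II] -/
def polarBit (s : ℕ) (j : Fin (2 ^ s)) (b : Fin (2 ^ s) → ZMod 2) : ZMod 2 :=
  ∑ i : Fin (2 ^ s), if i.val &&& j.val = j.val then b i else 0

/-- Sample space of `t = 2^s` independent copies of `(B, W') ∈ F₂ × F₂^m` (uniform). -/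
abbrev Cfg (s m : ℕ) : Type := Fin (2 ^ s) → ZMod 2 × (Fin m → ZMod 2)

variable {m : ℕ} {β : Type} [DecidableEq β]

/-- The `j`-th polarized bit `U_j = polarBit s j (B^{(1)}, …, B^{(t)})` of the copies' source bits. -/
def tgt (s : ℕ) (j : Fin (2 ^ s)) (X : Cfg s m) : ZMod 2 :=
  polarBit s j fun c => (X c).1

/-- The conditioning data of index `j`: the EARLIER polarized bits `U_{<j}` (as a masked vector:
entries `j' ≥ j` are zeroed, so the type does not depend on `j`) and the side information of all
copies `(g B^{(c)} W'^{(c)})_c`. -/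
def ctx (g : ZMod 2 → (Fin m → ZMod 2) → β) (s : ℕ) (j : Fin (2 ^ s)) (X : Cfg s m) :
    (Fin (2 ^ s) → ZMod 2) × (Fin (2 ^ s) → β) :=
  (fun j' => if j' < j then polarBit s j' (fun c => (X c).1) else 0, fun c => g (X c).1 (X c).2)

/-- The LEAKAGE PROFILE of the source `g` at block length `2^s`: `leak g s j = H(U_j | U_{<j}, Y^t)`,
spelled as a difference of Shannon entropies of images of the uniform distribution
(`mapEntropy`): `H((U_j, U_{<j}, Y^t)) − H((U_{<j}, Y^t))`.  In `[0, 1]`. [Arikan2010, §II–III] -/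
def leak (g : ZMod 2 → (Fin m → ZMod 2) → β) (s : ℕ) (j : Fin (2 ^ s)) : ℝ :=
  mapEntropy univ (fun X : Cfg s m => (tgt s j X, ctx g s j X)) - mapEntropy univ (ctx g s j)

/-- The conditional entropy `H(B | Y)` of the source bit given the side information `Y = g B W'`,
as `H((B, Y)) − H(Y)` over the uniform `(B, W')`. [folklore] -/
def condEnt (g : ZMod 2 → (Fin m → ZMod 2) → β) : ℝ :=
  mapEntropy univ (fun p : ZMod 2 × (Fin m → ZMod 2) => (p.1, g p.1 p.2)) -
    mapEntropy univ (fun p : ZMod 2 × (Fin m → ZMod 2) => g p.1 p.2)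

/-- **Conservation law of polarization (chain rule).** For every source `g` and every `s`:
`Σ_{j < 2^s} H(U_j | U_{<j}, Y^t) = 2^s · H(B | Y)`.  Why true: the `j`-th summand is
`H((U_{≤j}, Y^t)) − H((U_{<j}, Y^t))` up to injective recodings of the outputs
(`mapEntropy_comp_of_injOn`), so the sum telescopes to `H((U, Y^t)) − H(Y^t)`; `b ↦ b·F^{⊗s}` is a
bijection of `F₂^t` (an involution), so `H((U, Y^t)) = H((B^t, Y^t))`; and entropies of independent
tuples add (`mapEntropy_product`, iterated over `Fin (2^s)`), giving `2^s (H(B,Y) − H(Y))`.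
[Arikan2010, eq. before Thm 1 (`H(U^N | Y^N) = N·H(X|Y)`); Cover–Thomas Thm 2.5.1] [folklore] -/
@[folklore] def ChainRule : Prop :=
  ∀ (m : ℕ) (β : Type) [DecidableEq β] (g : ZMod 2 → (Fin m → ZMod 2) → β) (s : ℕ),
    ∑ j : Fin (2 ^ s), leak g s j = (2 : ℝ) ^ s * condEnt g

/-- **Two-sided ROUGH polarization with a polynomially small unpolarized fraction, uniformly over
all binary sources with side information** (KNOWN): there are absolute `μ > 0` and `C` such that for
every source `g` and every block length `t = 2^s`, at most `C · t^{1−μ}` indices `j` have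
`H(U_j | U_{<j}, Y^t) ∈ (t^{-μ}, 1 − t^{-μ})`.  Why true: `B` is uniform and independent of `W'`,
so `(B ; Y)` is a binary-input DMC with uniform input and `leak g s j` is the conditional entropy of
Arıkan's `j`-th synthetic source (`polarBit`: natural order = Arıkan's order for the copy-permuted
source); polarization [Arikan2010, Thm 1] with the polynomial rate of ROUGH polarization
[GuruswamiXia2015, rough-polarization step of Thm 1, absolute exponent; for sources with side
information directly GuruswamiVelingker2015; two-sided potential `E[(Z_n(1−Z_n))^α] ≤ c·2^{-nρ}` with
the BMS range `Z⁻ ∈ [Z√(2−Z²), 2Z−Z²]`, `Z⁺ = Z²`: MondelliHassaniUrbanke2016, Lemmas 5–6], and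
`Z² ≤ H ≤ log₂(1+Z)` [Arikan2010, Prop. 2] to pass between the Bhattacharyya and entropy processes;
non-symmetric `(B;Y)` are symmetrised by `W_s(y,a|x) = ½W(y|x⊕a)` (same `H`/`Z` processes) where a
printed statement assumes symmetry.  One `μ` serves for window and count w.l.o.g.; small `s` are
absorbed by `C`. -/
@[cite "Arikan2010" "Thm 1, Prop. 2"] def PolarizeRough : Prop :=
  ∃ μ : ℝ, 0 < μ ∧ ∃ C : ℝ, ∀ (m : ℕ) (β : Type) [DecidableEq β]
    (g : ZMod 2 → (Fin m → ZMod 2) → β) (s : ℕ),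
    ((univ.filter fun j : Fin (2 ^ s) =>
        (2 : ℝ) ^ (-(μ * s)) < leak g s j ∧ leak g s j < 1 - (2 : ℝ) ^ (-(μ * s))).card : ℝ)
      ≤ C * (2 : ℝ) ^ ((1 - μ) * s)

/-- The FINE polarization threshold at block length `2^s`: `2^{-2^{⌊s/4⌋}}` (i.e. `2^{-t^β}` with
`β ≈ 1/4 < 1/2`, in pure `ℕ` arithmetic). -/
def fineEps (s : ℕ) : ℝ := ((2 : ℝ) ^ (2 ^ (s / 4)))⁻¹

/-- **Two-sided FINE polarization with a polynomially small unpolarized fraction** (KNOWN modulo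
assembling printed pieces; this stub isolates triage doubt (i)): absolute `μ > 0`, `C` such that for
every source `g` and `t = 2^s` at most `C·t^{1−μ}` indices have
`H(U_j | U_{<j}, Y^t) ∈ (2^{-2^{⌊s/4⌋}}, 1 − 2^{-2^{⌊s/4⌋}})`.  Why true: LOW side — rate of
polarization `Z_n ≤ 2^{-2^{nβ}}` for every `β < 1/2` and every B-DMC [ArikanTelatar2009], with
polynomially small deficit and fineness `2^{-N^{0.49}}` uniformly over channels [GuruswamiXia2015,
Thm 1; MondelliHassaniUrbanke2016, Thm 7 / Remark 9]; HIGH side — the mirror process `S_n = 1 − Z_n²`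
satisfies `S ≤ S²` resp. `≤ 2S` on the two branches because `Z(W⁻) ≥ Z√(2−Z²)` for every pair of
B-DMCs with uniform input [KoradaUrbanke2010, Lemma 17 (AM-GM + Jensen, no symmetry needed)], whence
`Pr(Z_n ≥ 1 − 2^{-2^{nβ}}) → 1 − I(W)` for every `β < 1/2` [KoradaUrbanke2010, Thm 16], and the
Guruswami–Xia bootstrapping from rough polarization (itself two-sided, see `PolarizeRough`) gives the
polynomial deficit verbatim for `S_n`; finally `H ≥ Z²` and `H ≤ log₂(1+Z)` [Arikan2010, Prop. 2]
convert `Z`-thresholds into `H`-thresholds (`β = 1/4` leaves the slack).  Why it might fail: only if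
the high-side bootstrapping hides a use of `Z⁺ = Z²` as an EQUALITY where `S⁻ ≤ S²` is an inequality
— it does not in [ArikanTelatar2009]/[GuruswamiXia2015] (both use the upper bounds only).  If it did,
the line falls back to `GapQL` (constant gap) via `stub_transfer`, see the module docstring. -/
@[cite "KoradaUrbanke2010" "Thm 16, Lemma 17"] def PolarizeFine : Prop :=
  ∃ μ : ℝ, 0 < μ ∧ ∃ C : ℝ, ∀ (m : ℕ) (β : Type) [DecidableEq β]
    (g : ZMod 2 → (Fin m → ZMod 2) → β) (s : ℕ),
    ((univ.filter fun j : Fin (2 ^ s) =>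
        fineEps s < leak g s j ∧ leak g s j < 1 - fineEps s).card : ℝ)
      ≤ C * (2 : ℝ) ^ ((1 - μ) * s)

/-! ## Vocabulary II — the one-bit leakage promise problems `GapQL` (constant gap) and `GapQLx`
(extreme gap) over sparse quadratic maps (`PolyMapF2`, the route's presentation) -/

/-- Instances: a number of variables `N` and a sparse map `P = u :: Φ : F₂^N → F₂^{1+M}` whose HEAD
output polynomial is the bit `u` and whose TAIL `Φ` is the conditioning map. -/
abbrev QLInst : Type := Σ N : ℕ, PolyMapF2 N

/-- Boolean encoding of `QLInst`: `N` in binary, then the route's encoding of sparse maps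
(as for `PEDInst`). [AroraBarak2009, §0.1] -/
def QLInst.encoding : Encoding QLInst Bool :=
  Encoding.sigmaBool PolyMapF2.encoding

/-- Syntactic promise: `P` is quadratic (`DegLE 2`) and its head polynomial `u` is affine-linear
(every monomial of `P.headD []` lists `≤ 1` variable). [folklore] -/
@[folklore] def IsQL {N : ℕ} (P : PolyMapF2 N) : Prop :=
  PolyMapF2.DegLE 2 P ∧ ∀ μ ∈ P.headD [], μ.length ≤ 1

/-- The LEAKAGE of the head bit given the tail: `qleak (u :: Φ) = H((u,Φ)(U_N)) − H(Φ(U_N)) =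
H(u(W) | Φ(W))` for `W` uniform on `F₂^N` (`PolyMapF2.entropy` = Shannon entropy of the output on a
uniform input; `qleak [] = 0`).  In `[0, 1]` by subadditivity (`mapEntropy_prod_le`). -/
def qleak {N : ℕ} (P : PolyMapF2 N) : ℝ :=
  PolyMapF2.entropy P - PolyMapF2.entropy P.tail

/-- `GapQL` (constant gap): YES = HIDDEN (`H(u|Φ) ≥ 2/3`), NO = DETERMINED (`H(u|Φ) ≤ 1/3`), on
instances satisfying `IsQL`.  `PEA₂ ≤_Cook GapQL` (`stub_transfer`) and conversely `GapQL` is decided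
by two `PEA₂`-evaluations to `±1/8` (direct products), so `GapQL ∈ PromiseBPP' ↔ crux`. -/
def GapQL : PromiseProblem :=
  PromiseProblem.ofEncoding QLInst.encoding
    {I : QLInst | IsQL I.2 ∧ (2 : ℝ) / 3 ≤ qleak I.2}
    {I : QLInst | IsQL I.2 ∧ qleak I.2 ≤ (1 : ℝ) / 3}

/-- The EXTREME gap as a function of the number of variables: `δ(N) = 2^{-(2^{⌊log₂ N⌋/8} + 1)}`
(`≈ 2^{-N^{1/8}}`, superpolynomially small; `≤ 1/4` always, so YES/NO below are disjoint).  The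
exponent `1/8` is half the fineness exponent `1/4` of `fineEps`: an instance on `N·2^s` variables
produced by `s ≥ ⌊log₂ N⌋ + 16` rounds of polarization has `fineEps s ≤ δ(N·2^s)`. -/
def xgap (N : ℕ) : ℝ := ((2 : ℝ) ^ (2 ^ (Nat.log 2 N / 8) + 1))⁻¹

/-- `GapQLx` (extreme gap; the card's `C⁺ = GapQL_extreme`, with `δ(N) ≈ 2^{-N^{1/8}}` on BOTH
sides): YES = HIDDEN `H(u|Φ) ≥ 1 − δ(N)`, NO = DETERMINED `H(u|Φ) ≤ δ(N)`, on `IsQL` instances with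
`N` declared variables.  (An instance declaring many unused variables only makes its own promise
more extreme; reductions first rename to the used variables.) -/
def GapQLx : PromiseProblem :=
  PromiseProblem.ofEncoding QLInst.encoding
    {I : QLInst | IsQL I.2 ∧ 1 - xgap I.1 ≤ qleak I.2}
    {I : QLInst | IsQL I.2 ∧ qleak I.2 ≤ xgap I.1}

/-! ### Sanity of the thresholds (sorry-free) -/

/-- `δ(N) > 0`. [folklore] -/
theorem xgap_pos (N : ℕ) : 0 < xgap N := by
  unfold xgap; positivity

/-- `δ(N) ≤ 1/4`, so the YES and NO sets of `GapQLx` are disjoint (`1 − δ ≥ 3/4 > 1/4 ≥ δ`). [folklore] -/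
theorem xgap_le_quarter (N : ℕ) : xgap N ≤ 1 / 4 := by
  unfold xgap
  have h4 : (4 : ℝ) ≤ 2 ^ (2 ^ (Nat.log 2 N / 8) + 1) := by
    calc (4 : ℝ) = 2 ^ 2 := by norm_num
      _ ≤ 2 ^ (2 ^ (Nat.log 2 N / 8) + 1) :=
        pow_le_pow_right₀ (by norm_num)
          (by have := Nat.one_le_two_pow (n := Nat.log 2 N / 8); omega)
  have := inv_anti₀ (by norm_num : (0 : ℝ) < 4) h4
  simpa [one_div] using this

/-- `0 < fineEps s ≤ 1/2`. [folklore] -/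
theorem fineEps_pos_le (s : ℕ) : 0 < fineEps s ∧ fineEps s ≤ 1 / 2 := by
  refine ⟨by unfold fineEps; positivity, ?_⟩
  unfold fineEps
  have h2 : (2 : ℝ) ≤ 2 ^ (2 ^ (s / 4)) := by
    calc (2 : ℝ) = 2 ^ 1 := by norm_num
      _ ≤ 2 ^ (2 ^ (s / 4)) := pow_le_pow_right₀ (by norm_num) Nat.one_le_two_pow
  have := inv_anti₀ (by norm_num : (0 : ℝ) < 2) h2
  simpa [one_div] using this

/-- `GapQLx` is a disjoint promise problem. [folklore] -/
theorem GapQLx_disjoint : GapQLx.Disjoint := by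
  refine PromiseProblem.disjoint_ofEncoding _ (Set.disjoint_left.2 fun I hY hN => ?_)
  have h1 := hY.2
  have h2 := hN.2
  have h3 := xgap_le_quarter I.1
  linarith

/-- `GapQL` is a disjoint promise problem. [folklore] -/
theorem GapQL_disjoint : GapQL.Disjoint := by
  refine PromiseProblem.disjoint_ofEncoding _ (Set.disjoint_left.2 fun I hY hN => ?_)
  have h1 := hY.2
  have h2 := hN.2
  linarith

/-! ## The six stubs -/

/-- **Stub 1 — conservation law (chain rule of polarization).** `ChainRule`: for every binary source
with functional side information and every `s`, `Σ_j leak g s j = 2^s · condEnt g`.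
Why plausibly true: it IS true (chain rule; see `ChainRule`).  Plan: (a) `H((tgt_j, ctx_j)) =
H(ctx_{j+1})` for `j+1 < 2^s` and `= H((U, Y^t))` for the last `j` — mutually injective recodings,
`mapEntropy_comp_of_injOn`; (b) `H(ctx_0) = H(Y^t)` (the masked vector is constantly `0`);
(c) `X ↦ (U, Y^t)` and `X ↦ (B^t, Y^t)` recode each other (`polarBit` rows form `F^{⊗s}`, invertible:
prove `(F^{⊗s})² = 1` from the bit formula, or triangularity `j ⊆ i`); (d) `t`-fold product rule
`mapEntropy univ (fun X : Fin t → α => fun c => f (X c)) = t · mapEntropy univ f` by induction on `t`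
via `Fin.consEquiv`/`mapEntropy_product` + `mapEntropy_univ_comp_equiv`.  Size M (~300 lines).
Leans on: `mapEntropy_comp_of_injOn`, `mapEntropy_univ_comp_equiv`, `mapEntropy_product`,
`mapEntropy_prod_reveal` (tree, proved). -/
theorem stub_chainRule : ChainRule := by
  sorry

/-- **Stub 2 — two-sided rough polarization, polynomial rate (KNOWN).** `PolarizeRough`.
Why plausibly true: it is a published theorem up to translation (see `PolarizeRough`): Arıkan's
source polarization [Arikan2010, Thm 1] + the universal polynomial rate of rough polarization
[GuruswamiXia2015; GuruswamiVelingker2015 for sources with side information;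
MondelliHassaniUrbanke2016, Lemmas 5–6 for the two-sided potential].  Formalisation plan: define the
conditional-entropy / Bhattacharyya processes of the synthetic sources `(U_j ; U_{<j}, Y^t)` on the
finite sample space `Cfg s m` (everything is a finite sum — no measure theory needed), prove the
one-step identities `H⁻ + H⁺ = 2H`, `Z⁺ = Z²`, `Z⁻ ≤ 2Z − Z²`, `Z⁻ ≥ Z√(2−Z²)` [Arikan2009, Prop. 5;
KoradaUrbanke2010, Lemma 17], the potential decay `E[(Z(1−Z))^α] ≤ 2^{-ρ s}` by the one-step sup
bound, then Markov.  Size XL (new to the tree; Mathlib has `Real.binEntropy`, no polar codes).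
Leans on: `leak`, `polarBit`, `mapEntropy` API; Mathlib `Real.logb`, `Real.rpow`, `Finset` sums. -/
theorem stub_polarizeRough : PolarizeRough := by
  sorry

/-- **Stub 3 — two-sided FINE polarization, polynomial rate (KNOWN modulo assembly; triage doubt (i)).**
`PolarizeFine`.  Why plausibly true / sources / the one conceivable gap: see `PolarizeFine`
([ArikanTelatar2009]; [KoradaUrbanke2010, Thm 16 + Lemma 17] for the high-entropy side, verbatim
the mirror argument with `S_n = 1 − Z_n²`; [GuruswamiXia2015, Thm 1] / [MondelliHassaniUrbanke2016,
Thm 7] for the polynomial deficit).  Plan: on top of Stub 2's processes, the Arıkan–Telatar /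
Guruswami–Xia bootstrapping: after `s₀ = Θ(log s)`… more precisely after a first block of `s/2` steps
rough polarization puts all but `C t^{-μ}` paths below `t^{-μ}` (resp. `S` below `t^{-μ}`); in the
remaining `s/2` steps a path with `≥ s/8` squaring steps among any window (Chernoff over the i.i.d.
branch bits, failure `2^{-Ω(s)}`) is driven below `2^{-2^{s/4}}`, doublings costing at most `2^{s/2}`.
Size XL.  Leans on: Stub 2's infrastructure; Mathlib Chernoff/Hoeffding for independent Bernoullis
(`ProbabilityTheory` or a direct binomial-tail count on `Fin s → Bool`). -/
theorem stub_polarizeFine : PolarizeFine := by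
  sorry

/-- **Stub 4 — the transfer: `PEA₂` Cook-reduces to constant-gap one-bit leakage.**
`ChainRule → PolarizeRough → (PEA 2).CookReducible GapQL`.
The reduction (Goldreich 2006 Def. 3, tree `PromiseProblem.CookReducible`: ONE oracle algorithm
correct against EVERY oracle that answers GapQL's promise instances correctly and anything else
arbitrarily): on `x = ⟨n, q, k⟩` with `q` quadratic — rename to the `n' ≤ |x|` used variables
(`H(q(U))` unchanged); fix `s` with `t = 2^s ≥ (8(1+C) n')^{1/μ}` and `t^{μ} ≥ 3` (`μ, C` the
absolute constants of `PolarizeRough`; the algorithm may depend on them); for every level `ℓ < n'`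
and index `j < t` query the `IsQL` instance on `N = n' t` variables
`P_{ℓ,j} = [U_{ℓ,j}] ++ [U_{ℓ,j'}]_{j'<j} ++ [x^{(c)}_{ℓ'}]_{c<t, ℓ'<ℓ} ++ q^{×t}` (polar rows are lists
of singleton monomials; `q^{×t}` by re-indexing, cf. `PolyMapF2.prod`); count `N₁ = #{answers [true]}`;
accept iff `2(n' t − N₁) ≥ (2k+1) t`.  Correctness: `qleak P_{ℓ,j} = leak g_ℓ s j` for the level-`ℓ`
source `g_ℓ (b, w') = (x_{<ℓ}, q x)` (`x` = `w'` with `b` inserted at `ℓ`; identify `F₂^{n't}` with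
`Cfg s (n'−1)` by `mapEntropy_univ_comp_equiv`, outputs by `mapEntropy_comp_of_injOn`); polarized
indices (`leak ≤ t^{-μ} ≤ 1/3` or `≥ 1 − t^{-μ}`) are promise instances, answered correctly, and
contribute error `≤ t^{-μ}` each to `|N₁ − Σ_{ℓ,j} leak|`, the `≤ C n' t^{1−μ}` unpolarized ones
`≤ 1` each; `Σ_{ℓ,j} leak = t · Σ_ℓ condEnt g_ℓ = t (n' − H(q(U)))` (ChainRule + telescoping over
levels, `H(X, q X) = n'`); so `|N₁/t − (n' − H)| ≤ (1+C) n' t^{-μ} ≤ 1/8 < 1/4`, separating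
`H ≥ k+1` from `H ≤ k`.  Resources: `n' t` queries of length `poly(|x|)`, poly-time step function
(`OracleAlg.IsPolyTime`; template: `karpAlg`/`isPolyTime_karpAlg` in `OracleProofs.lean`, the
clocked runs of `PromiseCookReductionsProofs.lean`).  Why it might fail: it cannot mathematically
(given the two hypotheses); the risk is the size of the TM-level construction.  Size L/XL.
Leans on: `PromiseProblem.CookReducible`, `OracleAlg`, `PEA`, `encode_mem_PEA_yes_iff/no_iff`,
`PolyMapF2.{eval, DegLE, entropy, prod, eval_prod, entropy_prod}`, `mapEntropy_*`, `ChainRule`,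
`PolarizeRough`. [Goldreich2006, §1.2 Def. 3] -/
theorem stub_transfer : ChainRule → PolarizeRough → (PEA 2).CookReducible GapQL := by
  sorry

/-- **Stub 5 — the boost: degree-preserving gap amplification, `GapQL ≤_Cook GapQLx`.**
`ChainRule → PolarizeFine → GapQL.CookReducible GapQLx` — the degree-2 substitute for the
Sahai–Vadhan polarization lemma (whose XOR step raises the degree to 3): one more round of ONE-BIT
source polarization.  On `⟨N, u :: Φ⟩` with `IsQL`: compute the coefficient vector `a` of the affine
`u` mod 2 (repeated monomials cancel); if `a = 0`, `qleak = 0`: output NO.  Else rename to used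
variables, pick `T ∈ GL_N(F₂)` with `(Tx)_0 = a·x`, substitute `x = T^{-1} y` in `Φ` (quadratic in
`y`, `≤ N²` monomials per monomial; entropies invariant: `mapEntropy_univ_comp_equiv`; the constant
of `u` is an output translation: `mapEntropy_comp_of_injOn`), so that the instance is the source
`B = y_0`, `W' = y_{>0}`, `g = Φ'`, with `condEnt g = qleak (u :: Φ)`.  With `s ≡ 0 (mod 8)`,
`s ≥ ⌊log₂ N⌋ + 16` and `2^s ≥ (16 C)^{1/μ}`: query, for `j < t = 2^s`, the instance
`⟨N t, [U_j] ++ [U_{j'}]_{j'<j} ++ Φ'^{×t}⟩` (its `qleak` is `leak g s j`; fine-polarized indices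
satisfy `leak ≤ fineEps s ≤ xgap (N t)` or `≥ 1 − xgap (N t)`: PROMISE instances of `GapQLx`, since
`⌊log₂ (N·2^s)⌋ = ⌊log₂ N⌋ + s` and `2^{s/4} ≥ 2^{(⌊log₂N⌋+s)/8} + 1`); count `N₁ = #[true]`; accept
iff `2 N₁ ≥ t`.  Correctness: `|N₁ − t·qleak| ≤ t·fineEps s + C t^{1−μ} ≤ t/8` by `ChainRule` +
`PolarizeFine`, and `qleak ≥ 2/3` vs `≤ 1/3`.  Why it might fail: not mathematically; TM-level size.
Size L (shares the polarize-and-count engine with Stub 4 — build it once, generically in the level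
data).  Leans on: as Stub 4, plus `GapQL`, `GapQLx`, `xgap`, `fineEps`, Mathlib `Matrix`/`LinearEquiv`
over `ZMod 2` for `T`. [Goldreich2006, §1.2 Def. 3] -/
theorem stub_boost : ChainRule → PolarizeFine → GapQL.CookReducible GapQLx := by
  sorry

/-- **Stub 6 — the OPEN CORE (hardest, load-bearing): extreme-gap one-bit quadratic leakage is in
promise-BPP.** `GapQLx ∈ PromiseBPP'`: a randomized polynomial-time algorithm that, given an affine
form `u` and a quadratic map `Φ` on `F₂^N` with the promise `H(u(W) | Φ(W)) ≤ δ(N)` (DETERMINED) or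
`≥ 1 − δ(N)` (HIDDEN), `δ(N) ≈ 2^{-N^{1/8}}`, tells which.  EQUIVALENT to the crux (Stubs 1–5 give
`⇐`; `⇒` by two `PEA₂` evaluations), so no hardness is assumed away; what the normal form buys
(card, Transfer (a)–(c)): ONE bit and an EXTREME gap — all divergences between the two conditional
laws `P_b = law(Φ(W) | u(W) = b)` (output laws of the two QUADRATIC restrictions of `Φ` to the
hyperplanes `u = b`) agree up to the gap and polynomial factors are free, so the closed-form degree-2
`L²` quantity, the `u`-twisted census `Σ_λ bias(λ·Φ + u)² = 2^{M−2}‖P₀ − P₁‖₂²` (each term an exact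
Dickson-rank evaluation), becomes available: DETERMINED ⇒ census `≥ (1 − 2δ)²` (Cauchy–Schwarz), and
for output-flat instances HIDDEN ⇒ census `≤ poly(N)·δ^{1/2}`; exact HIDDEN-witnesses exist at degree
2 (a direction `h` with `u(h) = 1` and `Φ(w+h) − Φ(w)` constant: `{x : Φ(x+h) = Φ(x)}` is empty or an
affine subspace — the card's First lemma, TRUE per triage).  KNOWN WALLS (card + triage, to be
honoured by any proof): the census is `#BIS`-hard to approximate as a number (Goldberg–Jerrum; wall
B1) — usable only one-sidedly through its light, kernel-attack-enumerable part, which is provably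
SILENT on LPN-like determined instances (`Φ = As + u'⊙v'`, `u = s₁`: all census mass on characters of
rank `Θ(N)`); erasure/rank statistics certify only the HIDDEN side (BSC dominates no BEC; the sibling
lever `erasure-proxy-mapdec` FAILED triage ×2 on Mrs-Gerber/information-combining extremality); the
squared-syndrome family §X of TRIAGE-r1-1 (`M(u⊙v)` restricted to a random affine `V`) enters as
opaque instances.  So the residual difficulty is exactly `MAPDEC_extreme` on the coding sub-family:
given a binary linear code and a bit, decide bit-MAP error on `BSC(1/4)` `≤ δ` vs posterior
`δ`-close to uniform — where coding theory (area theorem / GEXIT, duality, LP/SOS decoding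
relaxations) can be stated at all only because of the extreme gap.  Why it might fail: `GapQLx` may
simply not be in `prBPP` (then neither is the crux: `¬crux ⇒ thesis X ⇒` the summit given `PeaMemPH`,
Disproof §3) — e.g. if `MAPDEC_extreme` is LPN-hard in the worst case.  Size XL / open.
Leans on: everything above; `PolyMapF2`, `mapEntropy_univ_affine_zmod_two`, `card_fiber_linearMap`
(Dickson/rank evaluations), `PromiseProblem.mem_PromiseBPP'_of_fp_decider`,
`PromiseProblem.exists_amplifier_of_mem_PromiseBPP'`, `swap_mem_PromiseBPP'` (tree). -/
theorem stub_gapQLx : GapQLx ∈ PromiseBPP' := by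
  sorry

/-! ## Name-keyed aliases of the six stub statements (hypotheses of the composition)

`Registered.stub_X : Prop` is the statement of `stub_X` under the registered stub's short name, so
that `#h21_check_skeleton` (hypotheses admissible iff registered obligations / declared stubs BY NAME)
accepts `PeaTwoMemBPP_of : Registered.stub_chainRule → … → PeaTwoMemBPP`. -/
namespace Registered

/-- Statement of `stub_chainRule`. -/
abbrev stub_chainRule : Prop := ChainRule
/-- Statement of `stub_polarizeRough`. -/
abbrev stub_polarizeRough : Prop := PolarizeRough
/-- Statement of `stub_polarizeFine`. -/
abbrev stub_polarizeFine : Prop := PolarizeFine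
/-- Statement of `stub_transfer`. -/
abbrev stub_transfer : Prop := ChainRule → PolarizeRough → (PEA 2).CookReducible GapQL
/-- Statement of `stub_boost`. -/
abbrev stub_boost : Prop := ChainRule → PolarizeFine → GapQL.CookReducible GapQLx
/-- Statement of `stub_gapQLx`. -/
abbrev stub_gapQLx : Prop := GapQLx ∈ PromiseBPP'

end Registered

/-! ## Glue (sorry-free) and the composition -/

/-- The crux is literally the library statement `PEA 2 ∈ PromiseBPP'` (same encoding, same sets;
cf. `Disproof.peaTwoMemBPP_iff`). [folklore] -/
theorem peaTwoMemBPP_iff :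
    Summit.PneNP.PneNP.Theses.SzkEntropy.PeaTwoMemBPP ↔ PEA 2 ∈ PromiseBPP' :=
  Iff.rfl

/-- **`PeaTwoMemBPP` from the six stubs** (concludes the crux BY NAME).  `GapQLx ∈ PromiseBPP'`
(Stub 6) and `GapQL ≤_Cook GapQLx` (Stub 5, from Stubs 1 and 3) give `GapQL ∈ PromiseBPP'` by the
PROVED closure of promise-BPP under Cook reductions
(`PromiseProblem.mem_PromiseBPP'_of_cookReducible_holds`, Goldreich 2006, remark after Def. 3); then
`PEA 2 ≤_Cook GapQL` (Stub 4, from Stubs 1 and 2) gives `PEA 2 ∈ PromiseBPP'`, which is the crux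
(`peaTwoMemBPP_iff`). -/
theorem PeaTwoMemBPP_of (h₁ : Registered.stub_chainRule) (h₂ : Registered.stub_polarizeRough)
    (h₃ : Registered.stub_polarizeFine) (h₄ : Registered.stub_transfer)
    (h₅ : Registered.stub_boost) (h₆ : Registered.stub_gapQLx) :
    Summit.PneNP.PneNP.Theses.SzkEntropy.PeaTwoMemBPP :=
  peaTwoMemBPP_iff.2 <|
    PromiseProblem.mem_PromiseBPP'_of_cookReducible_holds _ _ (h₄ h₁ h₂)
      (PromiseProblem.mem_PromiseBPP'_of_cookReducible_holds _ _ (h₅ h₁ h₃) h₆)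

/-- Wiring check: the stubs themselves feed the composition. -/
example : Summit.PneNP.PneNP.Theses.SzkEntropy.PeaTwoMemBPP :=
  PeaTwoMemBPP_of stub_chainRule stub_polarizeRough stub_polarizeFine stub_transfer stub_boost
    stub_gapQLx

end Summit.PneNP.PneNP.Cruxes.PeaTwoMemBPP.PolarizeToOneBitLeakage

end
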